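import Literature.MathematicalPhysics.QuantumLattice.HubbardFreePropagatorTorusDecay
import Literature.Analysis.Fourier.TorusDescendCalculus
import HarnessLib

/-!
# Momentum sums of a sampled SMOOTH periodic symbol: the torus-comparison tail, an explicit rate from derivative
# bounds, and uniform-in-`L` decay in the torus distance — for ANY symbol

Topic `Probability/LatticeModels`; the symbol-GENERIC complement of
`Literature/MathematicalPhysics/QuantumLattice/HubbardFreePropagatorPeriodization.lean` (§Sampling: `torusPoint L k = k/L ∈ 𝕋^d`,
`mFourier_torusPoint`, `apply_torusPoint_eq_latticeFourierTorus`, **`torusFourierInv_apply_torusPoint_eq_tsum`**: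
`L^{-d} Σ_{k ∈ (ℤ/Lℤ)^d} χ_k(z̄) Φ(k/L) = Σ_{n ∈ ℤ^d} ĉ(-(z + Ln))` for `Φ ∈ C(𝕋^d, ℂ)` with `Σ|ĉ| < ∞`; the rest of that file and
`HubbardFreePropagatorTorusDecay.lean` instantiate it for the FREE Hubbard symbol `f_β(ε - μ)` only).  Here the finite-size clause, its
rate and the uniform decay are stated for an arbitrary symbol, so that other propagators (e.g. a UV-cutoff symbol, one Matsubara
frequency at a time) only have to supply derivative bounds:

* §1 (continuous `Φ`, `Σ|ĉ| < ∞`) `torusFourierInv_apply_torusPoint_eq_tsum_sub` (the image sum indexed forward, `= Σ_n ĉ(Ln - z)`),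
  **`norm_torusFourierInv_apply_torusPoint_sub_le`** (Glimm–Jaffe §7.3 via the tree's `norm_tsum_translate_sub_le`):
  `‖L^{-d} Σ_k χ_k(z̄) Φ(k/L) - ĉ(-z)‖ ≤ Σ_{n ∉ box d R} ‖ĉ(n)‖` whenever `R + 1 + Σᵢ|zᵢ| ≤ L` — position-space information on the
  INFINITE-lattice kernel `a(z) = ĉ(-z)` transfers to every large volume at the price of a coefficient tail; `norm_torusFourierInv_apply_torusPoint_le`
  (`≤ Σ‖ĉ‖` uniformly); bridge `torusPoint_eq_torusGridPoint` (`rfl`) to `Literature/Analysis/Fourier/TorusGridPoissonSummation`.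
* §2 SMOOTH PERIODIC SYMBOLS (`g : EuclideanSpace ℝ (Fin d) → ℂ`, `Torus.IsLatticePeriodic g`, `ContDiff ℝ ∞ g`, sampled as
  `g(k/L) = Torus.descend g _ (torusPoint L k)`, `descend_torusGridPoint`): `Σ|ĉ| < ∞` is automatic (`Torus.summable_norm_mFourierCoeff_scalar`),
  so periodisation (`torusFourierInv_smoothSample_eq_tsum`) and the tail clause (`norm_torusFourierInv_smoothSample_sub_le_tail`) hold outright.
* §3 EXPLICIT RATE [cite: Grafakos2014, Thm. 3.3.9]: the complement of `box d R` is the tail region `{∃ i, 2R + 2 ≤ 2|nᵢ|}` of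
  `TorusFourierTailSmooth`, hence from `‖D^M g‖ ≤ D` (`2d ≤ M`, `d ≥ 1`), by `TorusDescendCalculus.tsum_tail_norm_mFourierCoeff_descend_le`:
  **`norm_torusFourierInv_smoothSample_sub_le_of_iteratedFDeriv`** —
  `‖L^{-d} Σ_k χ_k(z̄) g(k/L) - ĉ(-z)‖ ≤ D·(2π)^{-M}·(2/(2R+2))^{M-2d}·2^d·C_d` for EVERY `L ≥ R + 1 + Σᵢ|zᵢ|`, `C_d = Σ_{k ∈ ℤ^d} ∏ⱼ(1 + kⱼ²)⁻¹`.
* §4 UNIFORM-IN-`L` DECAY [cite: GlimmJaffeQP1987, §7.3]: the explicit coefficient majorant `‖ĉ(k)‖ ≤ max(D₀, D/π^M)·(1 + ‖k‖_∞)^{-M}` from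
  `‖g‖ ≤ D₀`, `‖D^M g‖ ≤ D` (`norm_mFourierCoeff_descend_le_inv_pow`) and `PeriodizedDecay.norm_tsum_translate_le_of_decay` give
  **`norm_torusFourierInv_smoothSample_le_inv_pow`**: `|L^{-d} Σ_k χ_k(z̄) g(k/L)| ≤ max(D₀, D/π^M)·(1 + 4^M S_M)·(1 + ‖z‖_∞)^{-M}` for every `L ≥ 1`
  and every CENTRED site `2‖z‖_∞ ≤ L` (`S_M = Σ_n (1 + ‖n‖_∞)^{-M}`, finite for `2d ≤ M`: `summable_inv_one_add_norm_pow`) — the finite-volume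
  kernel decays in the torus distance like the infinite-volume one with an `L`-INDEPENDENT, EXPLICIT constant
  (the existential-constant free-propagator instance is `exists_norm_hubbardThermalTwoPoint_zero_interaction_le`).

Everything is proved; no definitions, no named facts (BGM 2006 §2.2 footnote 1: «our bounds can be adapted also to the finite `L` case,
and the resulting estimates turn out to be uniform in `L`» — this file is that adaptation for the sampling step, symbol-generic).

## Mathlib / tree search

Tree (reused, not restated): `QuantumLattice.torusPoint`, `torusFourierInv_apply_torusPoint_eq_tsum`, `summable_inv_one_add_norm_pow`
(HubbardFreePropagator{Periodization,TorusDecay}); `DiscretePoissonSummation.norm_tsum_translate_sub_le`, `tsum_subtype_notMem_eq_tsum_ite`;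
`PeriodizedDecay.norm_tsum_translate_le_of_decay`; `Fourier.torusGridPoint`, `descend_torusGridPoint`, `isSmooth_descend`,
`tsum_tail_norm_mFourierCoeff_descend_le`, `norm_partialDeriv_iterate_descend_le`; `Torus.norm_mFourierCoeff_le_of_partialDeriv_iterate`,
`Torus.norm_mFourierCoeff_le_of_forall_norm_le`, `Torus.summable_norm_mFourierCoeff_scalar`.  (A same-day generic twin
`Literature/Probability/LatticeModels/SampledSymbolPeriodisation.lean` duplicates §Sampling of `HubbardFreePropagatorPeriodization` and is NOT
imported here.)

## References

* L. Grafakos, *Classical Fourier Analysis*, 3rd ed., GTM 249 (2014), §3.1.1, Prop. 3.2.5, Thm. 3.3.9, §3.3.3. [Grafakos2014]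
* J. Glimm, A. Jaffe, *Quantum Physics*, 2nd ed. (1987), §7.3, Prop. 7.3.1 and the estimates following it. [GlimmJaffeQP1987]
* G. Benfatto, A. Giuliani, V. Mastropietro, Ann. Henri Poincaré 7 (2006) 809–898, §2.1 (2.3)–(2.4), §2.2 footnote 1. [BenfattoGiulianiMastropietro2006]
-/

noncomputable section

open Finset Filter Complex UnitAddTorus MeasureTheory
open Literature.Analysis.Fourier Literature.Analysis.FunctionSpaces Literature.Analysis.FunctionSpaces.Torus
open Literature.MathematicalPhysics.QuantumLattice
open scoped ComplexConjugate Topology Real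

namespace Literature.Probability.LatticeModels

variable {d L : ℕ}

/-! ### §1 Continuous symbols with summable coefficients: the tail clause and the uniform bound -/

section Continuous

variable [NeZero L] (Φ : C(UnitAddTorus (Fin d), ℂ)) (hΦ : Summable fun n => ‖mFourierCoeff Φ n‖)
include hΦ

omit [NeZero L] hΦ in
/-- `QuantumLattice.torusPoint` (free-propagator file) IS `Fourier.torusGridPoint` (grid Poisson summation file). [cite: FriedliVelenikSMLS2017, §10.5.2] -/
theorem torusPoint_eq_torusGridPoint (L : ℕ) (k : TorusSite d L) : torusPoint L k = torusGridPoint L k := rfl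

/-- The image sum indexed forward: `L^{-d} Σ_k χ_k(z̄) Φ(k/L) = Σ_{n ∈ ℤ^d} ĉ(Ln - z)`. [cite: GlimmJaffeQP1987, Prop. 7.3.1] -/
theorem torusFourierInv_apply_torusPoint_eq_tsum_sub (z : Site d) :
    torusFourierInv (fun k : TorusSite d L => Φ (torusPoint L k)) (Torus.proj L z) =
      ∑' n : Site d, mFourierCoeff Φ ((L : ℤ) • n - z) := by
  rw [torusFourierInv_apply_torusPoint_eq_tsum Φ hΦ z, ← (Equiv.neg (Site d)).tsum_eq]
  refine tsum_congr fun n => ?_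
  rw [Equiv.neg_apply]
  congr 1
  simp only [smul_neg, neg_add_rev, neg_neg]
  abel

omit [NeZero L] hΦ in
/-- The box `{-R,…,R}^d` is symmetric, so a coefficient tail outside it may be indexed by `n` or by `-n`. [cite: GlimmJaffeQP1987, §7.3] -/
theorem tsum_notMem_box_norm_comp_neg (c : Site d → ℂ) (R : ℕ) :
    ∑' x : {x // x ∉ box d R}, ‖c (-x)‖ = ∑' n : {n // n ∉ box d R}, ‖c n‖ := by
  rw [tsum_subtype_notMem_eq_tsum_ite (a := fun x => c (-x)), tsum_subtype_notMem_eq_tsum_ite, ← (Equiv.neg (Site d)).tsum_eq]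
  refine tsum_congr fun x => ?_
  have hbox : -x ∈ box d R ↔ x ∈ box d R := by
    simp only [mem_box, Pi.neg_apply]
    exact ⟨fun h i => ⟨by linarith [(h i).2], by linarith [(h i).1]⟩, fun h i => ⟨by linarith [(h i).2], by linarith [(h i).1]⟩⟩
  simp only [Equiv.neg_apply, neg_neg, hbox]

/-- **The torus-comparison clause** (Glimm–Jaffe 1987 §7.3; BGM 2006 §2.2 footnote 1): for every box radius `R` with `R + 1 + Σᵢ|zᵢ| ≤ L`,
the momentum sum differs from the infinite-volume kernel `a(z) = ĉ(-z)` by at most the coefficient tail outside the box (all non-zero images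
lie outside it): `‖L^{-d} Σ_k χ_k(z̄) Φ(k/L) - ĉ(-z)‖ ≤ Σ_{n ∉ box d R} ‖ĉ(n)‖`. [cite: GlimmJaffeQP1987, §7.3] -/
theorem norm_torusFourierInv_apply_torusPoint_sub_le {R : ℕ} (z : Site d) (hR : (R : ℤ) + 1 + ∑ i, |z i| ≤ L) :
    ‖torusFourierInv (fun k : TorusSite d L => Φ (torusPoint L k)) (Torus.proj L z) - mFourierCoeff Φ (-z)‖ ≤
      ∑' n : {n // n ∉ box d R}, ‖mFourierCoeff Φ n‖ := by
  have ha : Summable fun x : Site d => ‖mFourierCoeff Φ (-x)‖ := (hΦ.comp_injective neg_injective :)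
  rw [torusFourierInv_apply_torusPoint_eq_tsum Φ hΦ z, ← tsum_notMem_box_norm_comp_neg]
  exact norm_tsum_translate_sub_le (a := fun x => mFourierCoeff Φ (-x)) ha (NeZero.ne L) z hR

/-- **A uniform-in-`L` pointwise bound**: `‖L^{-d} Σ_k χ_k(z̄) Φ(k/L)‖ ≤ Σ_n ‖ĉ(n)‖` for every `L ≥ 1` and every `z`. [cite: GlimmJaffeQP1987, §7.3] -/
theorem norm_torusFourierInv_apply_torusPoint_le (z : Site d) :
    ‖torusFourierInv (fun k : TorusSite d L => Φ (torusPoint L k)) (Torus.proj L z)‖ ≤ ∑' n : Site d, ‖mFourierCoeff Φ n‖ := by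
  rw [torusFourierInv_apply_torusPoint_eq_tsum_sub Φ hΦ z]
  have hinj : Function.Injective fun n : Site d => (L : ℤ) • n - z := by
    intro m n h
    have h' : (L : ℤ) • m = (L : ℤ) • n := sub_left_injective h
    exact smul_right_injective (Site d) (Int.natCast_ne_zero.2 (NeZero.ne L)) h'
  have hs : Summable fun n : Site d => ‖mFourierCoeff Φ ((L : ℤ) • n - z)‖ := (hΦ.comp_injective hinj :)
  refine (norm_tsum_le_tsum_norm hs).trans ?_
  exact hs.tsum_le_tsum_of_inj _ hinj (fun n _ => norm_nonneg _) (fun n => le_rfl) hΦ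

end Continuous

/-! ### §2 Smooth periodic symbols: the hypotheses discharge -/

section Smooth

variable [NeZero L] {g : EuclideanSpace ℝ (Fin d) → ℂ} (hper : Torus.IsLatticePeriodic g) (hs : ContDiff ℝ (⊤ : ℕ∞) g)
include hper hs

omit [NeZero L] in
/-- For a smooth lattice-periodic `g` the Fourier coefficients of its descent are absolutely summable. [cite: Grafakos2014, §3.3.3] -/
theorem summable_norm_mFourierCoeff_descend : Summable fun n => ‖mFourierCoeff (Torus.descend g hper) n‖ :=
  Torus.summable_norm_mFourierCoeff_scalar (isSmooth_descend g hper hs)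

omit [NeZero L] hs in
/-- The sample of a periodic symbol at the torus momentum `k` is its descent at `torusPoint L k`. [cite: Grafakos2014, §3.1.1] -/
theorem smoothSample_eq_descend_torusPoint (k : TorusSite d L) :
    g (WithLp.toLp 2 fun i => ((k i).val : ℝ) / L) = Torus.descend g hper (torusPoint L k) := by
  rw [torusPoint_eq_torusGridPoint, descend_torusGridPoint]

/-- **Periodisation, smooth form (unconditional)**: for a smooth `ℤ^d`-periodic `g` on `ℝ^d`, every `L ≥ 1` and `z ∈ ℤ^d`,
`L^{-d} Σ_{k ∈ (ℤ/Lℤ)^d} χ_k(z̄) g(k/L) = Σ_{n ∈ ℤ^d} ĉ(-(z + Ln))`, `ĉ` the Fourier coefficients of the descent of `g`.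
[cite: GlimmJaffeQP1987, Prop. 7.3.1] -/
theorem torusFourierInv_smoothSample_eq_tsum (z : Site d) :
    torusFourierInv (fun k : TorusSite d L => g (WithLp.toLp 2 fun i => ((k i).val : ℝ) / L)) (Torus.proj L z) =
      ∑' n : Site d, mFourierCoeff (Torus.descend g hper) (-(z + (L : ℤ) • n)) := by
  simp_rw [smoothSample_eq_descend_torusPoint hper]
  exact torusFourierInv_apply_torusPoint_eq_tsum (⟨Torus.descend g hper, continuous_descend g hper hs.continuous⟩ : C(UnitAddTorus (Fin d), ℂ))
    (summable_norm_mFourierCoeff_descend hper hs) z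

/-- **Torus-comparison clause, smooth form (unconditional)**: for `R + 1 + Σᵢ|zᵢ| ≤ L`,
`‖L^{-d} Σ_k χ_k(z̄) g(k/L) - ĉ(-z)‖ ≤ Σ_{n ∉ box d R} ‖ĉ(n)‖`. [cite: GlimmJaffeQP1987, §7.3] -/
theorem norm_torusFourierInv_smoothSample_sub_le_tail {R : ℕ} (z : Site d) (hR : (R : ℤ) + 1 + ∑ i, |z i| ≤ L) :
    ‖torusFourierInv (fun k : TorusSite d L => g (WithLp.toLp 2 fun i => ((k i).val : ℝ) / L)) (Torus.proj L z) -
        mFourierCoeff (Torus.descend g hper) (-z)‖ ≤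
      ∑' n : {n // n ∉ box d R}, ‖mFourierCoeff (Torus.descend g hper) n‖ := by
  simp_rw [smoothSample_eq_descend_torusPoint hper]
  exact norm_torusFourierInv_apply_torusPoint_sub_le (⟨Torus.descend g hper, continuous_descend g hper hs.continuous⟩ : C(UnitAddTorus (Fin d), ℂ))
    (summable_norm_mFourierCoeff_descend hper hs) z hR

/-- **Uniform bound, smooth form**: `‖L^{-d} Σ_k χ_k(z̄) g(k/L)‖ ≤ Σ_n ‖ĉ(n)‖` for every `L` and `z`. [cite: GlimmJaffeQP1987, §7.3] -/
theorem norm_torusFourierInv_smoothSample_le_tsum (z : Site d) :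
    ‖torusFourierInv (fun k : TorusSite d L => g (WithLp.toLp 2 fun i => ((k i).val : ℝ) / L)) (Torus.proj L z)‖ ≤
      ∑' n : Site d, ‖mFourierCoeff (Torus.descend g hper) n‖ := by
  simp_rw [smoothSample_eq_descend_torusPoint hper]
  exact norm_torusFourierInv_apply_torusPoint_le (⟨Torus.descend g hper, continuous_descend g hper hs.continuous⟩ : C(UnitAddTorus (Fin d), ℂ))
    (summable_norm_mFourierCoeff_descend hper hs) z

/-! ### §3 The explicit rate from derivative bounds -/

omit [NeZero L] hper hs in
/-- The complement of the box `{-R,…,R}^d` is the tail region `{n : ∃ i, 2R + 2 ≤ 2|nᵢ|}` of `TorusFourierTailSmooth`. [cite: Grafakos2014, §3.3.3] -/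
theorem not_mem_box_iff_tail (R : ℕ) (n : Site d) : n ∉ box d R ↔ ∃ i, (((2 * R + 2 : ℕ) : ℤ)) ≤ 2 * |n i| := by
  rw [mem_box, not_forall]
  refine exists_congr fun i => ?_
  rw [not_and_or, not_le, not_le]
  push_cast
  constructor
  · rintro (h | h)
    · have : (R : ℤ) + 1 ≤ -n i := by omega
      have := abs_of_neg (show n i < 0 by omega); omega
    · have := abs_of_pos (show 0 < n i by omega); omega
  · intro h
    rcases le_or_gt 0 (n i) with h0 | h0
    · rw [abs_of_nonneg h0] at h; right; omega
    · rw [abs_of_neg h0] at h; left; omega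

omit [NeZero L] hper hs in
/-- The box-complement tail of a coefficient sequence, written in the `ite` form of `TorusFourierTailSmooth`. [cite: Grafakos2014, §3.3.3] -/
theorem tsum_notMem_box_eq_tsum_ite_tail (c : Site d → ℂ) (R : ℕ) :
    ∑' n : {n // n ∉ box d R}, ‖c n‖ = ∑' n : Site d, (if ∃ i, (((2 * R + 2 : ℕ) : ℤ)) ≤ 2 * |n i| then ‖c n‖ else 0) := by
  rw [tsum_subtype_notMem_eq_tsum_ite]
  refine tsum_congr fun n => ?_
  by_cases h : n ∈ box d R
  · rw [if_pos h, if_neg (fun h' => (not_mem_box_iff_tail R n).2 h' h)]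
  · rw [if_neg h, if_pos ((not_mem_box_iff_tail R n).1 h)]

omit [NeZero L] in
/-- **The box-complement Fourier tail of a smooth periodic function from derivative bounds**: if `‖D^M g‖ ≤ D` on `ℝ^d` with `2d ≤ M`
(`d ≥ 1`), then `Σ_{n ∉ box d R} ‖ĉ(n)‖ ≤ D·(2π)^{-M}·(2/(2R+2))^{M-2d}·2^d·C_d`, `C_d = Σ_{k ∈ ℤ^d} ∏ⱼ(1 + kⱼ²)⁻¹`
(`TorusDescendCalculus.tsum_tail_norm_mFourierCoeff_descend_le` at threshold `N = 2R + 2`). [cite: Grafakos2014, Thm. 3.3.9] -/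
theorem tsum_notMem_box_norm_mFourierCoeff_descend_le [NeZero d] {M : ℕ} (hM : 2 * d ≤ M) {D : ℝ}
    (hD : ∀ y, ‖iteratedFDeriv ℝ M g y‖ ≤ D) (R : ℕ) :
    ∑' n : {n // n ∉ box d R}, ‖mFourierCoeff (Torus.descend g hper) n‖ ≤
      D / (2 * Real.pi) ^ M * (2 / ((2 * R + 2 : ℕ) : ℝ)) ^ (M - 2 * d) * (2 ^ d * ∑' k : Site d, ∏ j, (1 + (k j : ℝ) ^ 2)⁻¹) := by
  rw [tsum_notMem_box_eq_tsum_ite_tail]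
  have h := tsum_tail_norm_mFourierCoeff_descend_le (d := Fin d) hs hper (M := M) (by rwa [Fintype.card_fin]) hD
    (N := 2 * R + 2) (by omega)
  simp only [Fintype.card_fin] at h
  refine le_of_eq_of_le (tsum_congr fun n => ?_) h
  by_cases hx : ∃ i, ((2 * R + 2 : ℕ) : ℤ) ≤ 2 * |n i|
  · rw [if_pos hx, if_pos hx]
  · rw [if_neg hx, if_neg hx]

/-- **Torus-comparison with an explicit rate**: for a smooth `ℤ^d`-periodic `g` on `ℝ^d` with `‖D^M g‖ ≤ D` (`2d ≤ M`, `d ≥ 1`), every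
box radius `R` and EVERY volume `L ≥ R + 1 + Σᵢ|zᵢ|`,
`‖L^{-d} Σ_k χ_k(z̄) g(k/L) - ĉ(-z)‖ ≤ D·(2π)^{-M}·(2/(2R+2))^{M-2d}·2^d·C_d` — the infinite-lattice kernel `a(z) = ĉ(-z)` is within
`O((R+1)^{-(M-2d)})` of the finite-volume kernel, uniformly in `L`. [cite: BenfattoGiulianiMastropietro2006, §2.2 footnote 1] -/
theorem norm_torusFourierInv_smoothSample_sub_le_of_iteratedFDeriv [NeZero d] {M : ℕ} (hM : 2 * d ≤ M) {D : ℝ}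
    (hD : ∀ y, ‖iteratedFDeriv ℝ M g y‖ ≤ D) {R : ℕ} (z : Site d) (hR : (R : ℤ) + 1 + ∑ i, |z i| ≤ L) :
    ‖torusFourierInv (fun k : TorusSite d L => g (WithLp.toLp 2 fun i => ((k i).val : ℝ) / L)) (Torus.proj L z) -
        mFourierCoeff (Torus.descend g hper) (-z)‖ ≤
      D / (2 * Real.pi) ^ M * (2 / ((2 * R + 2 : ℕ) : ℝ)) ^ (M - 2 * d) * (2 ^ d * ∑' k : Site d, ∏ j, (1 + (k j : ℝ) ^ 2)⁻¹) :=
  (norm_torusFourierInv_smoothSample_sub_le_tail hper hs z hR).trans (tsum_notMem_box_norm_mFourierCoeff_descend_le hper hs hM hD R)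

/-! ### §4 Uniform-in-`L` decay of the finite-volume kernel in the torus distance -/

omit [NeZero L] in
/-- **Explicit coefficient majorant in the sup norm**: if `‖g‖ ≤ D₀` and `‖D^M g‖ ≤ D` on `ℝ^d` (`d ≥ 1`), then
`‖ĉ(k)‖ ≤ max(D₀, D/π^M)·(1 + ‖k‖_∞)^{-M}` for every `k ∈ ℤ^d` (decay in the largest coordinate, and `1 + ‖k‖_∞ ≤ 2‖k‖_∞` for `k ≠ 0`).
[cite: Grafakos2014, Thm. 3.3.9] -/
theorem norm_mFourierCoeff_descend_le_inv_pow [NeZero d] {M : ℕ} {D₀ D : ℝ} (h0 : ∀ y, ‖g y‖ ≤ D₀)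
    (hD : ∀ y, ‖iteratedFDeriv ℝ M g y‖ ≤ D) (k : Site d) :
    ‖mFourierCoeff (Torus.descend g hper) k‖ ≤ max D₀ (D / Real.pi ^ M) * ((1 + ‖k‖) ^ M)⁻¹ := by
  have hsm := isSmooth_descend g hper hs
  by_cases hk : k = 0
  · subst hk
    rw [norm_zero, add_zero, one_pow, inv_one, mul_one]
    refine le_trans ?_ (le_max_left _ _)
    refine Torus.norm_mFourierCoeff_le_of_forall_norm_le (fun t => ?_) 0
    rw [Torus.descend_apply]
    exact h0 _
  · -- the largest coordinate `j₀`: `‖k‖ = |k j₀| ≥ 1`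
    obtain ⟨j₀, -, hj₀⟩ := Finset.exists_max_image Finset.univ (fun j => |(k j : ℝ)|) Finset.univ_nonempty
    have hnorm : ‖k‖ = |(k j₀ : ℝ)| := by
      apply le_antisymm
      · rw [pi_norm_le_iff_of_nonneg (abs_nonneg _)]
        intro j
        rw [Int.norm_eq_abs]
        exact hj₀ j (Finset.mem_univ j)
      · have := norm_le_pi_norm k j₀
        rwa [Int.norm_eq_abs] at this
    have hk0 : k j₀ ≠ 0 := by
      intro h
      apply hk
      funext j
      have hj := hj₀ j (Finset.mem_univ j)
      rw [h, Int.cast_zero, abs_zero] at hj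
      exact_mod_cast abs_nonpos_iff.1 hj
    have hone : (1 : ℝ) ≤ |(k j₀ : ℝ)| := by exact_mod_cast Int.one_le_abs hk0
    have hD0 : 0 ≤ D := le_trans (norm_nonneg _) (hD 0)
    have h1 : ‖mFourierCoeff (Torus.descend g hper) k‖ ≤ D / (2 * Real.pi * |(k j₀ : ℝ)|) ^ M :=
      Torus.norm_mFourierCoeff_le_of_partialDeriv_iterate hsm j₀ M hk0
        (fun t => norm_partialDeriv_iterate_descend_le hs hper j₀ M hD t)
    have hpi : 0 < Real.pi := Real.pi_pos
    have h2 : D / (2 * Real.pi * |(k j₀ : ℝ)|) ^ M ≤ D / Real.pi ^ M * ((1 + ‖k‖) ^ M)⁻¹ := by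
      have hle : Real.pi * (1 + ‖k‖) ≤ 2 * Real.pi * |(k j₀ : ℝ)| := by rw [hnorm]; nlinarith
      have hpow : (Real.pi * (1 + ‖k‖)) ^ M ≤ (2 * Real.pi * |(k j₀ : ℝ)|) ^ M := pow_le_pow_left₀ (by positivity) hle M
      have hpos : 0 < (Real.pi * (1 + ‖k‖)) ^ M := by positivity
      calc D / (2 * Real.pi * |(k j₀ : ℝ)|) ^ M ≤ D / (Real.pi * (1 + ‖k‖)) ^ M := div_le_div_of_nonneg_left hD0 hpos hpow
        _ = D / Real.pi ^ M * ((1 + ‖k‖) ^ M)⁻¹ := by rw [mul_pow, ← div_div, div_eq_mul_inv]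
    exact h1.trans (h2.trans (mul_le_mul_of_nonneg_right (le_max_right _ _) (by positivity)))

/-- **Uniform-in-`L` decay of the finite-volume kernel in the torus distance** (Glimm–Jaffe 1987 §7.3; BGM 2006 §2.2 footnote 1 «our bounds can be
adapted also to the finite `L` case … uniform in `L`»): for a smooth `ℤ^d`-periodic `g` on `ℝ^d` with `‖g‖ ≤ D₀`, `‖D^M g‖ ≤ D`, `2d ≤ M`, `d ≥ 1`,
every `L ≥ 1` and every CENTRED site `z` (`2‖z‖_∞ ≤ L`, i.e. `‖z‖_∞` is the torus distance of `z̄` to `0`):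
`|L^{-d} Σ_k χ_k(z̄) g(k/L)| ≤ max(D₀, D/π^M)·(1 + 4^M·Σ_n (1 + ‖n‖_∞)^{-M})·(1 + ‖z‖_∞)^{-M}` — the momentum sum decays in the torus distance like
the infinite-volume kernel, with an `L`-independent explicit constant. [cite: GlimmJaffeQP1987, §7.3] -/
theorem norm_torusFourierInv_smoothSample_le_inv_pow [NeZero d] {M : ℕ} (hM : 2 * d ≤ M) {D₀ D : ℝ} (h0 : ∀ y, ‖g y‖ ≤ D₀)
    (hD : ∀ y, ‖iteratedFDeriv ℝ M g y‖ ≤ D) {z : Site d} (hz : 2 * ‖z‖ ≤ L) :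
    ‖torusFourierInv (fun k : TorusSite d L => g (WithLp.toLp 2 fun i => ((k i).val : ℝ) / L)) (Torus.proj L z)‖ ≤
      max D₀ (D / Real.pi ^ M) * (1 + (4 : ℝ) ^ M * ∑' n : Site d, ((1 + ‖n‖) ^ M)⁻¹) * ((1 + ‖z‖) ^ M)⁻¹ := by
  rw [torusFourierInv_smoothSample_eq_tsum hper hs z]
  have hC : 0 ≤ max D₀ (D / Real.pi ^ M) := le_trans (le_trans (norm_nonneg _) (h0 0)) (le_max_left _ _)
  have ha : ∀ x : Site d, ‖mFourierCoeff (Torus.descend g hper) (-x)‖ ≤ max D₀ (D / Real.pi ^ M) * ((1 + ‖x‖) ^ M)⁻¹ := fun x => by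
    simpa only [norm_neg] using norm_mFourierCoeff_descend_le_inv_pow hper hs h0 hD (-x)
  have hL : 1 ≤ L := Nat.one_le_iff_ne_zero.2 (NeZero.ne L)
  simpa only [neg_add_rev] using
    norm_tsum_translate_le_of_decay (a := fun x : Site d => mFourierCoeff (Torus.descend g hper) (-x)) hC ha
      (summable_inv_one_add_norm_pow hM) hL hz

end Smooth

/-! ### §5 (append) Off-site refinement: for `z ∉ Lℤ^d` only the DERIVATIVE constant enters -/

section OffSite

variable [NeZero L]

omit [NeZero L] in
/-- **The coefficient majorant at a NONZERO frequency uses derivatives only**: `‖ĉ(k)‖ ≤ (D/π^M)·(1 + ‖k‖_∞)^{-M}` for `k ≠ 0` when `‖D^M g‖ ≤ D`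
(no `sup‖g‖`). [cite: Grafakos2014, Thm. 3.3.9] -/
theorem norm_mFourierCoeff_descend_le_inv_pow_of_ne_zero [NeZero d] {g : EuclideanSpace ℝ (Fin d) → ℂ} (hper : Torus.IsLatticePeriodic g)
    (hs : ContDiff ℝ (⊤ : ℕ∞) g) {M : ℕ} {D : ℝ} (hD : ∀ y, ‖iteratedFDeriv ℝ M g y‖ ≤ D) {k : Site d} (hk : k ≠ 0) :
    ‖mFourierCoeff (Torus.descend g hper) k‖ ≤ D / Real.pi ^ M * ((1 + ‖k‖) ^ M)⁻¹ := by
  have hsm := isSmooth_descend g hper hs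
  obtain ⟨j₀, -, hj₀⟩ := Finset.exists_max_image Finset.univ (fun j => |(k j : ℝ)|) Finset.univ_nonempty
  have hnorm : ‖k‖ = |(k j₀ : ℝ)| := by
    apply le_antisymm
    · rw [pi_norm_le_iff_of_nonneg (abs_nonneg _)]
      intro j
      rw [Int.norm_eq_abs]
      exact hj₀ j (Finset.mem_univ j)
    · have := norm_le_pi_norm k j₀
      rwa [Int.norm_eq_abs] at this
  have hk0 : k j₀ ≠ 0 := by
    intro h
    apply hk
    funext j
    have hj := hj₀ j (Finset.mem_univ j)
    rw [h, Int.cast_zero, abs_zero] at hj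
    exact_mod_cast abs_nonpos_iff.1 hj
  have hone : (1 : ℝ) ≤ |(k j₀ : ℝ)| := by exact_mod_cast Int.one_le_abs hk0
  have hD0 : 0 ≤ D := le_trans (norm_nonneg _) (hD 0)
  have h1 : ‖mFourierCoeff (Torus.descend g hper) k‖ ≤ D / (2 * Real.pi * |(k j₀ : ℝ)|) ^ M :=
    Torus.norm_mFourierCoeff_le_of_partialDeriv_iterate hsm j₀ M hk0
      (fun t => norm_partialDeriv_iterate_descend_le hs hper j₀ M hD t)
  have hpi : 0 < Real.pi := Real.pi_pos
  have hle : Real.pi * (1 + ‖k‖) ≤ 2 * Real.pi * |(k j₀ : ℝ)| := by rw [hnorm]; nlinarith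
  have hpow : (Real.pi * (1 + ‖k‖)) ^ M ≤ (2 * Real.pi * |(k j₀ : ℝ)|) ^ M := pow_le_pow_left₀ (by positivity) hle M
  have hpos : 0 < (Real.pi * (1 + ‖k‖)) ^ M := by positivity
  calc ‖mFourierCoeff (Torus.descend g hper) k‖ ≤ D / (2 * Real.pi * |(k j₀ : ℝ)|) ^ M := h1
    _ ≤ D / (Real.pi * (1 + ‖k‖)) ^ M := div_le_div_of_nonneg_left hD0 hpos hpow
    _ = D / Real.pi ^ M * ((1 + ‖k‖) ^ M)⁻¹ := by rw [mul_pow, ← div_div, div_eq_mul_inv]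

omit [NeZero L] in
/-- **Sum over images avoiding the origin**: if `z̄ ≠ 0` on the torus, no image `z + Ln` is `0`, so a kernel may be modified at the origin
without changing `Σ_n a(z + Ln)`. [cite: GlimmJaffeQP1987, §7.3] -/
theorem tsum_translate_eq_of_proj_ne_zero (a b : Site d → ℂ) (hab : ∀ x, x ≠ 0 → a x = b x) {z : Site d} (hz : Torus.proj L z ≠ 0) :
    ∑' n : Site d, a (z + (L : ℤ) • n) = ∑' n : Site d, b (z + (L : ℤ) • n) := by
  refine tsum_congr fun n => hab _ fun h => hz ?_
  have h2 : Torus.proj L (z + (L : ℤ) • n) = Torus.proj L z := Torus.proj_add_zsmul L z n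
  rw [← h2, h]
  funext i
  simp [Torus.proj]

variable {g : EuclideanSpace ℝ (Fin d) → ℂ} (hper : Torus.IsLatticePeriodic g) (hs : ContDiff ℝ (⊤ : ℕ∞) g)
include hper hs

/-- **Off-site L-uniform decay — the constant part of the symbol never enters.**  For a smooth `ℤ^d`-periodic `g` with `‖D^M g‖ ≤ D` (`2d ≤ M`,
`d ≥ 1`), every `L ≥ 1` and every CENTRED site `z` with `z̄ ≠ 0` on the torus (`2‖z‖_∞ ≤ L`, `z ∉ Lℤ^d`):
`|L^{-d} Σ_k χ_k(z̄) g(k/L)| ≤ (D/π^M)·(1 + 4^M·Σ_n (1+‖n‖_∞)^{-M})·(1+‖z‖_∞)^{-M}` — no `sup‖g‖`: only the coefficients `ĉ(k)`, `k ≠ 0`, enter an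
off-site value (a momentum-independent part of the symbol is invisible off site), and those are controlled by derivatives alone.
[cite: GlimmJaffeQP1987, §7.3] -/
theorem norm_torusFourierInv_smoothSample_le_inv_pow_offSite [NeZero d] {M : ℕ} (hM : 2 * d ≤ M) {D : ℝ}
    (hD : ∀ y, ‖iteratedFDeriv ℝ M g y‖ ≤ D) {z : Site d} (hz : 2 * ‖z‖ ≤ L) (hz0 : Torus.proj L z ≠ 0) :
    ‖torusFourierInv (fun k : TorusSite d L => g (WithLp.toLp 2 fun i => ((k i).val : ℝ) / L)) (Torus.proj L z)‖ ≤
      (D / Real.pi ^ M) * (1 + (4 : ℝ) ^ M * ∑' n : Site d, ((1 + ‖n‖) ^ M)⁻¹) * ((1 + ‖z‖) ^ M)⁻¹ := by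
  classical
  rw [torusFourierInv_smoothSample_eq_tsum hper hs z]
  set b : Site d → ℂ := fun x => if x = 0 then 0 else mFourierCoeff (Torus.descend g hper) (-x) with hb
  have hab : ∀ x : Site d, x ≠ 0 → mFourierCoeff (Torus.descend g hper) (-x) = b x := fun x hx => by simp [hb, hx]
  have hrw := tsum_translate_eq_of_proj_ne_zero (L := L) (fun x => mFourierCoeff (Torus.descend g hper) (-x)) b hab hz0
  rw [show (∑' n : Site d, mFourierCoeff (Torus.descend g hper) (-(z + (L : ℤ) • n))) = ∑' n : Site d, b (z + (L : ℤ) • n) from hrw]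
  have hD0 : 0 ≤ D := le_trans (norm_nonneg _) (hD 0)
  have hC : 0 ≤ D / Real.pi ^ M := by positivity
  have hbnd : ∀ x : Site d, ‖b x‖ ≤ D / Real.pi ^ M * ((1 + ‖x‖) ^ M)⁻¹ := by
    intro x
    by_cases hx : x = 0
    · simp only [hb, hx, if_true, norm_zero]; positivity
    · simp only [hb, hx, if_false]
      simpa only [norm_neg] using norm_mFourierCoeff_descend_le_inv_pow_of_ne_zero hper hs hD (k := -x) (neg_ne_zero.2 hx)
  have hL : 1 ≤ L := Nat.one_le_iff_ne_zero.2 (NeZero.ne L)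
  exact norm_tsum_translate_le_of_decay (a := b) hC hbnd (summable_inv_one_add_norm_pow hM) hL hz

end OffSite

end Literature.Probability.LatticeModels

end
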